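import Mathlib
import Literature.NumberTheory.LFunctions.Zhang2022.SkeletonPartThree
import HarnessLib

/-!
# Zhang (2022), §16: (16.17) from (16.2) and the evaluation of `Φ₂(p)`; the in-line claim
# `(pt₀)^{β₁} = −1 + O(α₁)` discharged — kernel-checked

Topic `Literature/NumberTheory/LFunctions/Zhang2022` (Landau–Siegel audit tree; verdict-neutral).
Y. Zhang, *Discrete mean estimates and the Landau–Siegel zero*, arXiv:2211.02515v1 (2022)
[Zhang2022LandauSiegel] — **an unrefereed manuscript under adjudication**; the nodes referred to are
CLAIM nodes of `SkeletonPartThree` / `Typed.Section16A` / `Typed.Section16B`, stated not asserted.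
DAG node `Z22:(16.17)` (cone C39, coarse node `Skeleton.Ded1617`), last step of §16 (p. 95,
tex L4680–L4687):

> This together with (16.16) and (16.12) yields `Φ₂(p) = −(𝔢₁ + 𝔢₂)𝔞p + o(p)`.
> Since `(pt₀)^{β₁} = −1 + O(α₁)`, it follows by (16.2) that `Φ₂ = (𝔢₁ + 𝔢₂)𝔞𝔓 + o(𝔓)`. (16.17)

Proved here (skeleton vocabulary only; the one-line specialisations to the typed §16 nodes
`Typed.Section16A.Eq16_2`, `Typed.Section16B.U045`, `Typed.Section16B.PtPowBeta1` live in the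
companion file `Section16Eval1617Typed`):

* `norm_primeWindow_cpow_beta1_add_one_le` — the in-line claim "`(pt₀)^{β₁} = −1 + O(α₁)`"
  (DAG `Z22:§16.u045`/`(16.17)`) with the constant `523 + 2635|c′|`: `β₁ = iα(1 − 5c′α𝓛)`,
  `α = π/𝓛⁹`, `t₀ = 𝓛⁵¹⁹`, `P < p < P(1 + 𝓛⁻⁶⁸)`, so
  `β₁log(pt₀) − iπ = i[(αlog p − π) + αlog t₀ − 5c′α²𝓛log(pt₀)]`, each bracket `O(α𝓛)`;
  and `|(pt₀)^{β₁}| = 1` (`norm_primeWindow_cpow_beta1`).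
* `eval1617_of_parts` — for ANY function `Φ₂(p)`: the display (16.2)
  "`Φ₂ = Σ_{p∼P}(pt₀)^{β₁}Φ₂(p) + o(𝔓)`" [Z22 p.89, tex L4449] and the display
  "`Φ₂(p) = −(𝔢₁+𝔢₂)𝔞p + o(p)` (p ∼ P)" [Z22 p.95, tex L4683] imply the node `Eval1617` = (16.17).
  The absorption of `O(α₁𝔞𝔓)` into the printed `o(𝔓)` needs `α₁𝔞 → 0`: supplied by `frakA_le`
  (`𝔞 = (6/π²)L′(1,χ)²∏_{q∣D}q/(q+1) ≤ 16e⁹𝓛⁴`, from the tree's Cauchy estimate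
  `Lemma31.norm_deriv_LFunction_le_near_one`), so `α₁𝔞 ≤ 16πe⁹𝓛⁻⁴`.

What is NOT asserted: (16.2), the evaluation of `Φ₂(p)`, (16.17) itself, or anything upstream
(Prop. 14.1, Lemmas 15.1, 16.1, 16.2). Nothing about Theorems 1–2 of the source is stated or
implied; nothing here bears on the cell's verdict on (8.24).

## References

* Y. Zhang, arXiv:2211.02515v1 (2022), §16 (16.2), (16.3), (16.17), p. 95; §2 (2.10), (2.13), (2.31).
  [cite: Zhang2022LandauSiegel, §16 (16.17)]
-/
noncomputable section

open Complex Real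

namespace Literature.NumberTheory.LFunctions.Zhang2022.Skeleton

/-! ## Pure-imaginary powers of positive reals -/

/-- For real `x > 0` and real `b, θ`: `x^{ib} = e^{i b log x}`, hence
`‖x^{ib} − e^{iθ}‖ ≤ |b log x − θ|`. [folklore] -/
private theorem norm_ofReal_cpow_I_mul_sub_exp_le {x : ℝ} (hx : 0 < x) (b θ : ℝ) :
    ‖(x : ℂ) ^ (I * b) - Complex.exp (θ * I)‖ ≤ |b * Real.log x - θ| := by
  have hx0 : (x : ℂ) ≠ 0 := ofReal_ne_zero.mpr hx.ne'
  have h1 : (x : ℂ) ^ (I * b) = Complex.exp ((b * Real.log x : ℝ) * I) := by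
    rw [Complex.cpow_def_of_ne_zero hx0, ← Complex.ofReal_log hx.le]
    congr 1
    push_cast
    ring
  have h2 : Complex.exp ((b * Real.log x : ℝ) * I) - Complex.exp (θ * I) =
      Complex.exp (θ * I) * (Complex.exp (I * (b * Real.log x - θ : ℝ)) - 1) := by
    rw [mul_sub, mul_one, ← Complex.exp_add]
    congr 2
    push_cast
    ring
  rw [h1, h2, norm_mul, Complex.norm_exp_ofReal_mul_I, one_mul]
  exact (Real.norm_exp_I_mul_ofReal_sub_one_le).trans (by rw [Real.norm_eq_abs])

/-- For real `x > 0` and real `b`: `|x^{ib}| = 1`. [folklore] -/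
private theorem norm_ofReal_cpow_I_mul {x : ℝ} (hx : 0 < x) (b : ℝ) : ‖(x : ℂ) ^ (I * b)‖ = 1 := by
  have hx0 : (x : ℂ) ≠ 0 := ofReal_ne_zero.mpr hx.ne'
  have h1 : (x : ℂ) ^ (I * b) = Complex.exp ((b * Real.log x : ℝ) * I) := by
    rw [Complex.cpow_def_of_ne_zero hx0, ← Complex.ofReal_log hx.le]
    congr 1
    push_cast
    ring
  rw [h1, Complex.norm_exp_ofReal_mul_I]

/-! ## The shift `β₁` and the window `p ∼ P` -/

section Window

variable (c' : ℝ) {D : ℕ}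

/-- `β₁ = i·b₁` with the real `b₁ = α(1 − 5c′α𝓛)`. [cite: Zhang2022LandauSiegel, §2 (2.13)] -/
theorem beta1_eq_I_mul (D : ℕ) :
    beta1 c' D = I * ((alpha D * (1 - 5 * c' * alpha D * ell D) : ℝ) : ℂ) := by
  rw [beta1]
  push_cast
  ring

/-- `α > 0` once `𝓛 > 0`. [cite: Zhang2022LandauSiegel, §2 (2.10)] -/
theorem alpha_pos_of_ell_pos (h : 0 < ell D) : 0 < alpha D := by
  rw [alpha, log_bigP D]; exact div_pos Real.pi_pos (pow_pos h _)

/-- `α𝓛⁹ = π`. [cite: Zhang2022LandauSiegel, §2 (2.10)] -/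
theorem alpha_mul_ell_pow_nine (h : 0 < ell D) : alpha D * ell D ^ 9 = π := by
  rw [alpha, log_bigP D, div_mul_cancel₀ _ (pow_pos h _).ne']

/-- Members of the window satisfy `P < p < P(1 + 𝓛⁻⁶⁸)`. [cite: Zhang2022LandauSiegel, §2 p. 4] -/
theorem bigP_lt_and_lt_of_mem_primeWindow {p : ℕ} (hp : p ∈ primeWindow D) :
    bigP D < p ∧ (p : ℝ) < bigP D * (1 + (ell D ^ 68)⁻¹) := by
  simp only [primeWindow, Finset.mem_filter, Finset.mem_Ioo] at hp
  refine ⟨Nat.lt_of_floor_lt hp.1.1, ?_⟩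
  have h2 := hp.1.2
  have : (p : ℝ) ≤ (⌈bigP D * (1 + (ell D ^ 68)⁻¹)⌉₊ : ℝ) - 1 := by
    have : p + 1 ≤ ⌈bigP D * (1 + (ell D ^ 68)⁻¹)⌉₊ := h2
    have := (Nat.cast_le (α := ℝ)).mpr this
    push_cast at this
    linarith
  have h0 : (0 : ℝ) ≤ bigP D * (1 + (ell D ^ 68)⁻¹) := by
    have := Real.exp_pos (ell D ^ 9); rw [← bigP] at this; positivity
  exact lt_of_le_of_lt this (by linarith [Nat.ceil_lt_add_one h0])

/-- For `p ∼ P` and `𝓛 ≥ 1`: `0 ≤ log p − log P ≤ 𝓛⁻⁶⁸`. [cite: Zhang2022LandauSiegel, §2 p. 4] -/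
theorem log_sub_log_bigP_of_mem_primeWindow (hℓ : 1 ≤ ell D) {p : ℕ} (hp : p ∈ primeWindow D) :
    0 ≤ Real.log p - Real.log (bigP D) ∧ Real.log p - Real.log (bigP D) ≤ (ell D ^ 68)⁻¹ := by
  obtain ⟨h1, h2⟩ := bigP_lt_and_lt_of_mem_primeWindow hp
  have hP : 0 < bigP D := Real.exp_pos _
  have hp0 : (0 : ℝ) < p := hP.trans h1
  have hinv : 0 < (ell D ^ 68)⁻¹ := by positivity
  constructor
  · linarith [Real.log_le_log hP h1.le]
  · have := Real.log_le_log hp0 h2.le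
    rw [Real.log_mul hP.ne' (by positivity)] at this
    linarith [Real.log_le_sub_one_of_pos (show 0 < 1 + (ell D ^ 68)⁻¹ by positivity)]

/-- **`(pt₀)^{β₁} = −1 + O(α₁)`** (§16 p. 95, tex L4685; DAG `Z22:§16.u045`), with an explicit
constant: for `𝓛 ≥ 3` and `p ∼ P`, `‖(pt₀)^{β₁} + 1‖ ≤ (523 + 2635|c′|)·α𝓛`
(`α₁ := α𝓛`). Proof: `(pt₀)^{β₁} = exp{ib₁ log(pt₀)}` and
`b₁log(pt₀) − π = (αlog p − π) + αlog t₀ − 5c′α²𝓛log(pt₀)` with `0 ≤ αlog p − π ≤ α𝓛⁻⁶⁸`,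
`αlog t₀ = 519α log𝓛 ≤ 519α𝓛`, `5|c′|α²𝓛 log(pt₀) = 5|c′|·α𝓛·(αlog(pt₀)) ≤ 5|c′|·α𝓛·524` (using `α𝓛 ≤ 1`).
[cite: Zhang2022LandauSiegel, §16 p. 95] -/
theorem norm_primeWindow_cpow_beta1_add_one_le (hℓ : 3 ≤ ell D) {p : ℕ} (hp : p ∈ primeWindow D) :
    ‖(((p : ℝ) * t0 D : ℝ) : ℂ) ^ beta1 c' D + 1‖ ≤ (523 + 2635 * |c'|) * (alpha D * ell D) := by
  have hℓ1 : 1 ≤ ell D := by linarith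
  have hℓ0 : 0 < ell D := by linarith
  obtain ⟨hPp, -⟩ := bigP_lt_and_lt_of_mem_primeWindow hp
  have hP : 0 < bigP D := Real.exp_pos _
  have hp0 : (0 : ℝ) < p := hP.trans hPp
  have ht0 : 0 < t0 D := pow_pos hℓ0 _
  have hx : 0 < (p : ℝ) * t0 D := mul_pos hp0 ht0
  have hα : 0 < alpha D := alpha_pos_of_ell_pos hℓ0
  have hαℓ9 : alpha D * ell D ^ 9 = π := alpha_mul_ell_pow_nine hℓ0
  -- `α𝓛 ≤ 1` : `α𝓛 = π/𝓛⁸ ≤ π/3⁸`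
  have hαℓ : alpha D * ell D ≤ 1 := by
    have h8 : (3 : ℝ) ^ 8 ≤ ell D ^ 8 := pow_le_pow_left₀ (by norm_num) hℓ 8
    have : alpha D * ell D * ell D ^ 8 = π := by rw [← hαℓ9]; ring
    nlinarith [Real.pi_lt_four, mul_pos hα hℓ0]
  set b : ℝ := alpha D * (1 - 5 * c' * alpha D * ell D) with hb
  have hβ : beta1 c' D = I * (b : ℂ) := beta1_eq_I_mul c' D
  -- rewrite `x^{β₁} + 1 = x^{ib} − e^{iπ}`
  have hrw : (((p : ℝ) * t0 D : ℝ) : ℂ) ^ beta1 c' D + 1 =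
      (((p : ℝ) * t0 D : ℝ) : ℂ) ^ (I * b) - Complex.exp (π * I) := by
    rw [hβ, Complex.exp_pi_mul_I]; ring
  rw [hrw]
  refine (norm_ofReal_cpow_I_mul_sub_exp_le hx b π).trans ?_
  -- the real estimate
  have hlogx : Real.log ((p : ℝ) * t0 D) = Real.log p + Real.log (t0 D) :=
    Real.log_mul hp0.ne' ht0.ne'
  have hlogt0 : Real.log (t0 D) = 519 * Real.log (ell D) := by
    rw [t0, Real.log_pow]; norm_num
  have hloglog : 0 ≤ Real.log (ell D) ∧ Real.log (ell D) ≤ ell D :=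
    ⟨Real.log_nonneg hℓ1, (Real.log_le_sub_one_of_pos hℓ0).trans (by linarith)⟩
  obtain ⟨hlp0, hlp1⟩ := log_sub_log_bigP_of_mem_primeWindow hℓ1 hp
  rw [log_bigP D] at hlp0 hlp1
  -- `α log p − π = α (log p − 𝓛⁹) ∈ [0, α𝓛⁻⁶⁸]`
  have hαlogp : alpha D * Real.log p - π = alpha D * (Real.log p - ell D ^ 9) := by
    rw [← hαℓ9]; ring
  have h68 : (ell D ^ 68)⁻¹ ≤ ell D := by
    rw [inv_le_comm₀ (pow_pos hℓ0 _) hℓ0]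
    calc (ell D)⁻¹ ≤ 1 := inv_le_one_of_one_le₀ hℓ1
      _ ≤ ell D ^ 68 := one_le_pow₀ hℓ1
  have hA : 0 ≤ alpha D * Real.log p - π ∧ alpha D * Real.log p - π ≤ alpha D * ell D := by
    rw [hαlogp]
    exact ⟨mul_nonneg hα.le hlp0, mul_le_mul_of_nonneg_left (hlp1.trans h68) hα.le⟩
  -- `α log t₀ ≤ 519 α𝓛`
  have hB : 0 ≤ alpha D * Real.log (t0 D) ∧ alpha D * Real.log (t0 D) ≤ 519 * (alpha D * ell D) := by
    rw [hlogt0]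
    exact ⟨by nlinarith [hloglog.1, hα.le], by nlinarith [hloglog.2, hα.le]⟩
  -- `α log(pt₀) ≤ π + 520 α𝓛 ≤ 524`
  have hC : 0 ≤ alpha D * Real.log ((p : ℝ) * t0 D) ∧
      alpha D * Real.log ((p : ℝ) * t0 D) ≤ 524 := by
    rw [hlogx, mul_add]
    constructor
    · linarith [hA.1, hB.1, Real.pi_pos.le]
    · linarith [hA.2, hB.2, Real.pi_lt_four]
  -- assemble: `b log x − π = (α log p − π) + α log t₀ − 5c′(α𝓛)(α log x)`
  have hexp : b * Real.log ((p : ℝ) * t0 D) - π =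
      (alpha D * Real.log p - π) + alpha D * Real.log (t0 D)
        - 5 * c' * (alpha D * ell D) * (alpha D * Real.log ((p : ℝ) * t0 D)) := by
    rw [hb, hlogx]; ring
  rw [hexp]
  have hαℓ0 : 0 ≤ alpha D * ell D := by positivity
  calc |(alpha D * Real.log p - π) + alpha D * Real.log (t0 D)
        - 5 * c' * (alpha D * ell D) * (alpha D * Real.log ((p : ℝ) * t0 D))|
      ≤ |(alpha D * Real.log p - π) + alpha D * Real.log (t0 D)|
        + |5 * c' * (alpha D * ell D) * (alpha D * Real.log ((p : ℝ) * t0 D))| := abs_sub _ _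
    _ ≤ 520 * (alpha D * ell D) + 5 * |c'| * (alpha D * ell D) * 524 := by
        gcongr
        · rw [abs_of_nonneg (by linarith [hA.1, hB.1])]; linarith [hA.2, hB.2]
        · rw [abs_mul, abs_mul, abs_mul, abs_of_nonneg hαℓ0, abs_of_nonneg hC.1,
            show |(5 : ℝ)| = 5 by norm_num]
          gcongr
          exact hC.2
    _ ≤ (523 + 2635 * |c'|) * (alpha D * ell D) := by nlinarith [abs_nonneg c']

/-- `|(pt₀)^{β₁}| = 1` for `p ∼ P` (`β₁` purely imaginary, `pt₀ > 0`).
[cite: Zhang2022LandauSiegel, §2 (2.13)] -/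
theorem norm_primeWindow_cpow_beta1 (hℓ : 0 < ell D) {p : ℕ} (hp : p ∈ primeWindow D) :
    ‖(((p : ℝ) * t0 D : ℝ) : ℂ) ^ beta1 c' D‖ = 1 := by
  obtain ⟨hPp, -⟩ := bigP_lt_and_lt_of_mem_primeWindow hp
  have hx : 0 < (p : ℝ) * t0 D := mul_pos ((Real.exp_pos _).trans hPp) (pow_pos hℓ _)
  rw [beta1_eq_I_mul, norm_ofReal_cpow_I_mul hx]

end Window

/-! ## The size of `𝔞` -/

section FrakA

variable {D : ℕ} [NeZero D] (χ : DirichletCharacter ℂ D)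

/-- **`𝔞 ≪ 𝓛⁴`**: for `χ` primitive mod `D` with `𝓛 = log D ≥ 3`,
`𝔞 = (6/π²)L′(1,χ)²∏_{q∣D}q/(q+1) ≤ 16e⁹𝓛⁴` (Cauchy's estimate `|L′(1,χ)| ≤ 2e^{9/2}(1+𝓛)𝓛`,
`∏ ≤ 1`, `6/π² ≤ 1`). The manuscript's "`o(𝔓)`" in (16.17) (and (15.24), (17.10)) absorbs
`O(α₁𝔞𝔓)`; this is the bound that makes `α₁𝔞 → 0`. [cite: Zhang2022LandauSiegel, §2 (2.31)] -/
theorem frakA_le (hℓ : 3 ≤ Real.log D) (hχ : χ.IsPrimitive) :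
    frakA χ ≤ 16 * Real.exp 9 * Real.log D ^ 4 := by
  rw [frakA, Lemma171.frakA_def]
  set L : ℝ := Real.log D
  have hL1 : 1 ≤ L := by linarith
  have hd : ‖deriv χ.LFunction 1‖ ≤ 2 * Real.exp (9 / 2) * (1 + L) * L :=
    Lemma31.norm_deriv_LFunction_le_near_one χ hℓ hχ (by simp; positivity)
  have hre : (deriv χ.LFunction 1).re ^ 2 ≤ (2 * Real.exp (9 / 2) * (1 + L) * L) ^ 2 := by
    have habs := Complex.abs_re_le_norm (deriv χ.LFunction 1)
    calc (deriv χ.LFunction 1).re ^ 2 ≤ ‖deriv χ.LFunction 1‖ ^ 2 :=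
          sq_le_sq' (abs_le.mp habs).1 (abs_le.mp habs).2
      _ ≤ _ := pow_le_pow_left₀ (norm_nonneg _) hd 2
  have hprod : ∏ p ∈ D.primeFactors, ((p : ℝ) / (p + 1)) ≤ 1 := by
    refine Finset.prod_le_one (fun p _ => by positivity) (fun p _ => ?_)
    rw [div_le_one (by positivity)]; linarith
  have hprod0 : 0 ≤ ∏ p ∈ D.primeFactors, ((p : ℝ) / (p + 1)) :=
    Finset.prod_nonneg fun p _ => by positivity
  have hπ : 6 / π ^ 2 ≤ 1 := by
    rw [div_le_one (by positivity)]; nlinarith [Real.pi_gt_three]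
  have he : Real.exp (9 / 2) ^ 2 = Real.exp 9 := by rw [← Real.exp_nat_mul]; norm_num
  calc 6 / π ^ 2 * (deriv χ.LFunction 1).re ^ 2 * ∏ p ∈ D.primeFactors, ((p : ℝ) / (p + 1))
      ≤ 1 * (2 * Real.exp (9 / 2) * (1 + L) * L) ^ 2 * 1 := by gcongr
    _ = 4 * Real.exp 9 * ((1 + L) * L) ^ 2 := by rw [← he]; ring
    _ ≤ 4 * Real.exp 9 * (2 * L * L) ^ 2 := by gcongr; linarith
    _ = 16 * Real.exp 9 * L ^ 4 := by ring

end FrakA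

/-! ## (16.17) from (16.2) and the evaluation of `Φ₂(p)` -/

section Assembly

variable (c' : ℝ)

/-- Any real threshold on `𝓛 = log D` is met for all large `D` ("`D` greater than a sufficiently
large … number", §2 p. 4). [cite: Zhang2022LandauSiegel, §2 (2.1)] -/
theorem exists_forall_le_ell (M : ℝ) : ∃ D₀ : ℕ, ∀ D : ℕ, D₀ ≤ D → M ≤ ell D := by
  refine ⟨⌈Real.exp M⌉₊ + 1, fun D hD => ?_⟩
  have hD1 : (⌈Real.exp M⌉₊ : ℝ) + 1 ≤ D := by exact_mod_cast hD
  have hD0 : (0 : ℝ) < D := by linarith [Nat.le_ceil (Real.exp M), Real.exp_pos M]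
  rw [ell, Real.le_log_iff_exp_le hD0]
  linarith [Nat.le_ceil (Real.exp M)]

/-- **(16.17) from (16.2) and the evaluation of `Φ₂(p)`** (§16 p. 95, tex L4680–L4687; DAG
`Z22:(16.17)` ⇐ `Z22:(16.2)` + `Z22:§16.u044`/`u045`): for ANY `Φ₂(p)` (in the manuscript, the
expression (16.3)), if "`Φ₂ = Σ_{p∼P}(pt₀)^{β₁}Φ₂(p) + o(𝔓)`" (16.2) and
"`Φ₂(p) = −(𝔢₁ + 𝔢₂)𝔞p + o(p)`" uniformly for `p ∼ P` (p. 95), then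
"`Φ₂ = (𝔢₁ + 𝔢₂)𝔞𝔓 + o(𝔓)`" (16.17) — the node `Eval1617`. The step "since
`(pt₀)^{β₁} = −1 + O(α₁)`" is `norm_primeWindow_cpow_beta1_add_one_le`, and the absorption of
`O(α₁𝔞𝔓)` into `o(𝔓)` is `frakA_le` (`α₁𝔞 ≤ 16e⁹π𝓛⁻⁴`). Exact identity used:
`Φ₂ − 𝔢𝔞𝔓 = (Φ₂ − Σ(pt₀)^{β₁}Φ₂(p)) + Σ(pt₀)^{β₁}(Φ₂(p) + 𝔢𝔞p) − Σ((pt₀)^{β₁} + 1)𝔢𝔞p`,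
`𝔢 = 𝔢₁ + 𝔢₂`, `𝔓 = Σ_{p∼P} p`. [cite: Zhang2022LandauSiegel, §16 (16.17)] -/
theorem eval1617_of_parts (Φ : (D : ℕ) → [NeZero D] → DirichletCharacter ℂ D → ℕ → ℂ)
    (h162 : ∀ ε : ℝ, 0 < ε → ForAllLarge fun D _ χ => AssumptionA D χ →
      ‖Phi2 c' χ - ∑ p ∈ primeWindow D, (((p : ℝ) * t0 D : ℝ) : ℂ) ^ beta1 c' D * Φ D χ p‖ ≤
        ε * frakP D)
    (hΦ : ∀ ε : ℝ, 0 < ε → ForAllLarge fun D _ χ => AssumptionA D χ → ∀ p ∈ primeWindow D,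
      ‖Φ D χ p + (frake 1 + frake 2) * frakA χ * p‖ ≤ ε * p) :
    Eval1617 c' := by
  intro ε hε
  set E : ℂ := frake 1 + frake 2 with hE
  have hε3 : 0 < ε / 3 := by positivity
  obtain ⟨D₁, h₁⟩ := (h162 _ hε3).and (hΦ _ hε3)
  -- the constant of the third error term and the threshold on `𝓛`
  set K : ℝ := (523 + 2635 * |c'|) * ‖E‖ * (16 * Real.exp 9) * π with hK
  have hK0 : 0 ≤ K := by positivity
  obtain ⟨D₂, h₂⟩ := exists_forall_le_ell (max 3 (3 * K / ε + 1))
  refine ⟨max D₁ D₂, fun D _ χ hD hq hp hA => ?_⟩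
  obtain ⟨e162, eΦ⟩ := h₁ D χ (le_trans (le_max_left _ _) hD) hq hp
  replace e162 := e162 hA
  replace eΦ := eΦ hA
  have hM := h₂ D (le_trans (le_max_right _ _) hD)
  have hℓ3 : 3 ≤ ell D := le_trans (le_max_left _ _) hM
  have hℓK : 3 * K / ε + 1 ≤ ell D := le_trans (le_max_right _ _) hM
  have hℓ0 : 0 < ell D := by linarith
  have hℓ1 : 1 ≤ ell D := by linarith
  -- `K/𝓛⁴ ≤ ε/3`
  have hℓ4 : 3 * K / ε ≤ ell D ^ 4 := by
    have : ell D ≤ ell D ^ 4 := le_self_pow₀ hℓ1 (by norm_num)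
    linarith
  have hKε : K / ell D ^ 4 ≤ ε / 3 := by
    rw [div_le_iff₀ (by positivity)]
    have : 3 * K ≤ ell D ^ 4 * ε := by rwa [div_le_iff₀ hε] at hℓ4
    linarith
  -- the two inputs on the window
  have hα5 : alpha D * ell D * ell D ^ 4 = π / ell D ^ 4 := by
    have h9 := alpha_mul_ell_pow_nine (D := D) hℓ0
    field_simp
    linear_combination h9
  have hα : 0 < alpha D := alpha_pos_of_ell_pos hℓ0
  have hAle : frakA χ ≤ 16 * Real.exp 9 * ell D ^ 4 := frakA_le χ hℓ3 hp
  have hA0 : 0 ≤ frakA χ := frakA_nonneg χ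
  -- abbreviation for the weights
  set w : ℕ → ℂ := fun p => (((p : ℝ) * t0 D : ℝ) : ℂ) ^ beta1 c' D with hw
  have hw1 : ∀ p ∈ primeWindow D, ‖w p‖ = 1 := fun p hp' =>
    norm_primeWindow_cpow_beta1 c' hℓ0 hp'
  have hw2 : ∀ p ∈ primeWindow D, ‖w p + 1‖ ≤ (523 + 2635 * |c'|) * (alpha D * ell D) :=
    fun p hp' => norm_primeWindow_cpow_beta1_add_one_le c' hℓ3 hp'
  -- `𝔓 = Σ_{p∼P} p`
  have hP : (frakP D : ℂ) = ∑ p ∈ primeWindow D, (p : ℂ) := by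
    rw [frakP_eq_sum_primeWindow]; push_cast; rfl
  -- the exact decomposition
  have hsum : ∑ p ∈ primeWindow D, w p * (Φ D χ p + E * frakA χ * p) -
      ∑ p ∈ primeWindow D, (w p + 1) * (E * frakA χ * p) =
      ∑ p ∈ primeWindow D, w p * Φ D χ p - ∑ p ∈ primeWindow D, E * frakA χ * p := by
    rw [← Finset.sum_sub_distrib, ← Finset.sum_sub_distrib]
    exact Finset.sum_congr rfl fun p _ => by ring
  have key : Phi2 c' χ - E * frakA χ * frakP D =
      (Phi2 c' χ - ∑ p ∈ primeWindow D, w p * Φ D χ p) +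
      (∑ p ∈ primeWindow D, w p * (Φ D χ p + E * frakA χ * p) -
        ∑ p ∈ primeWindow D, (w p + 1) * (E * frakA χ * p)) := by
    rw [hsum, hP, Finset.mul_sum]; ring
  -- termwise bounds
  have hB : ∀ p ∈ primeWindow D, ‖w p * (Φ D χ p + E * frakA χ * p)‖ ≤ ε / 3 * p := by
    intro p hp'
    rw [norm_mul, hw1 p hp', one_mul]
    exact eΦ p hp'
  have hC : ∀ p ∈ primeWindow D, ‖(w p + 1) * (E * frakA χ * p)‖ ≤ K / ell D ^ 4 * p := by
    intro p hp'
    have hn : ‖(E * frakA χ * p : ℂ)‖ = ‖E‖ * frakA χ * p := by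
      rw [norm_mul, norm_mul, Complex.norm_real, Real.norm_of_nonneg hA0, Complex.norm_natCast]
    rw [norm_mul, hn]
    calc ‖w p + 1‖ * (‖E‖ * frakA χ * p)
        ≤ (523 + 2635 * |c'|) * (alpha D * ell D) * (‖E‖ * (16 * Real.exp 9 * ell D ^ 4) * p) :=
          mul_le_mul (hw2 p hp') (by gcongr)
            (mul_nonneg (mul_nonneg (norm_nonneg _) hA0) (Nat.cast_nonneg _))
            (mul_nonneg (by positivity) (mul_pos hα hℓ0).le)
      _ = K / ell D ^ 4 * p := by
          rw [hK]
          have : (523 + 2635 * |c'|) * (alpha D * ell D) *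
              (‖E‖ * (16 * Real.exp 9 * ell D ^ 4) * (p : ℝ)) =
              (523 + 2635 * |c'|) * ‖E‖ * (16 * Real.exp 9) *
                (alpha D * ell D * ell D ^ 4) * p := by ring
          rw [this, hα5]; ring
  -- sum up
  have hPnn : 0 ≤ frakP D := frakP_nonneg D
  rw [key]
  calc ‖(Phi2 c' χ - ∑ p ∈ primeWindow D, w p * Φ D χ p) +
        (∑ p ∈ primeWindow D, w p * (Φ D χ p + E * frakA χ * p) -
          ∑ p ∈ primeWindow D, (w p + 1) * (E * frakA χ * p))‖
      ≤ ‖Phi2 c' χ - ∑ p ∈ primeWindow D, w p * Φ D χ p‖ +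
        (‖∑ p ∈ primeWindow D, w p * (Φ D χ p + E * frakA χ * p)‖ +
          ‖∑ p ∈ primeWindow D, (w p + 1) * (E * frakA χ * p)‖) :=
        (norm_add_le _ _).trans (by gcongr; exact norm_sub_le _ _)
    _ ≤ ε / 3 * frakP D + (∑ p ∈ primeWindow D, ε / 3 * (p : ℝ) +
          ∑ p ∈ primeWindow D, K / ell D ^ 4 * (p : ℝ)) :=
        add_le_add e162 (add_le_add ((norm_sum_le _ _).trans (Finset.sum_le_sum hB))
          ((norm_sum_le _ _).trans (Finset.sum_le_sum hC)))
    _ = (ε / 3 + ε / 3 + K / ell D ^ 4) * frakP D := by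
        rw [← Finset.mul_sum, ← Finset.mul_sum, frakP_eq_sum_primeWindow]; ring
    _ ≤ (ε / 3 + ε / 3 + ε / 3) * frakP D := by gcongr
    _ = ε * frakP D := by ring

end Assembly

end Literature.NumberTheory.LFunctions.Zhang2022.Skeleton
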